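import Summits.Ventures.DiscreteObjects.PP12.OrbitStructureOrderThree

/-!
# Sides under a collineation of order 3: equations (R1) and (R2) of the flag-cell orbit matrix at plane level (kernel; every `f`)
Framing: lottery ticket; floor = certified bounds/negative ranges.

Cell pub-namedobj (venture DiscreteObjects), target (M), designs gen 13; continuation of `OrbitCountOrderThree` /
`OrbitStructureOrderThree`. A *side* is a non-fixed line `a` through `Q` and `σQ` (`Q` not fixed) carrying no fixed point — in the
flag cells these are exactly the exterior lines (`FlagExterior.exterior_line_is_side`). For an arbitrary finite projective plane and
any collineation with `σ³ = 1`: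
* `filter_orb3_eq_pair_of_side` — a side meets the orbit of `Q` in exactly `{Q, σQ}`;
* **`side_tline_identity`** — (R2): against a non-fixed line `b` through a fixed point,
  `2·|orb3 Q ∩ b| + #{q ∈ a ∖ orb3 Q : orb3 q meets b} = 3`;
* **`side_side_identity`** — (R1): against a side `b` of a different orbit `orb3 Q'`,
  `2·|orb3 Q ∩ b| + 2·|orb3 Q' ∩ a| + #{q ∈ a ∖ (orb3 Q ∪ orb3 Q') : orb3 q meets b} = 3`.
* by duality (`σ.dual`): **`flag_tpoints_common_orbits`** (C4), **`vertex_tpoint_identity`** (C3), **`vertex_vertex_identity`**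
  (C1)/(C2), and **`point_common_lineOrbits_eq_three`** ((C5)/(C6): a non-fixed point on a fixed line against any other point).
* the orbit matrix indexed by the ORBITS themselves (`orbits3`, `lineOrbits3`; no representatives): **`orbit_row_identity_orbits`** /
  **`orbit_column_identity_orbits`** — `3·#{fixed points on a ∩ b} + Σ_{S ∈ orbits3 σ} |S ∩ a|·|S ∩ b| = 3 + n·[a ∈ orb3 b]`.
Together with `flag_tlines_common_orbits` (R3) these are ALL the row-pair and column-pair equation types of designs g12 FAMILY-FLAG7 §1
(and of `IsFlagTenOrbitMatrix` / `IsFlagSevenOrbitMatrix`) at plane level, before indexing.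
No `sorry`, no new axioms; nothing is specific to order 12.
-/

namespace Summit.Ventures.DiscreteObjects.PP12

open Configuration Finset
open scoped Classical

namespace Collineation

variable {P L : Type*} [Membership P L] (σ : Collineation P L)

section Plane

variable [ProjectivePlane P L]

/-- A line `a` through `Q` and `σQ` (`Q` not fixed) that is not fixed meets the orbit of `Q` in exactly the two points `Q, σQ`. -/
theorem filter_orb3_eq_pair_of_side {Q : P} (hQ : σ.onPoints Q ≠ Q) {a : L}
    (ha : σ.onLines a ≠ a) (hQa : Q ∈ a) (hσQa : σ.onPoints Q ∈ a) :
    (orb3 σ.onPoints Q).filter (fun q => q ∈ a) = {Q, σ.onPoints Q} := by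
  ext q
  rw [mem_filter, mem_orb3, mem_insert, mem_singleton]
  constructor
  · rintro ⟨h | h | h, hqa⟩
    · exact Or.inl h
    · exact Or.inr h
    · exfalso; rw [h] at hqa; exact ha (σ.line_fixed_of_orbit_subset hQ hQa hσQa hqa)
  · rintro (rfl | rfl)
    · exact ⟨Or.inl rfl, hQa⟩
    · exact ⟨Or.inr (Or.inl rfl), hσQa⟩

end Plane

variable [ProjectivePlane P L] [Fintype P] [Fintype L]

/-- **(R2) at plane level.** `σ³ = 1`; `a` a non-fixed line through `Q` and `σQ` carrying no fixed point (a 'side'); `b` a non-fixed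
line through a fixed point `y` (a 'T-line'). Then
`2 · |orb3 Q ∩ b| + #{q ∈ a, q ∉ orb3 Q : orb3 q meets b} = 3`
(orbit matrix: `2[i ∈ C] + [ψ i ∈ C] + Σ |R ∩ C'| + #{j : γ_j(i) = β_kj(C)} = 3`). -/
theorem side_tline_identity (hq : σ.onPoints ^ 3 = 1) {Q : P} (hQ : σ.onPoints Q ≠ Q) {a : L} (ha : σ.onLines a ≠ a)
    (hQa : Q ∈ a) (hσQa : σ.onPoints Q ∈ a) (ha0 : ∀ q : P, q ∈ a → σ.onPoints q ≠ q)
    {b : L} (hb : σ.onLines b ≠ b) {y : P} (hy : σ.onPoints y = y) (hyb : y ∈ b) :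
    2 * ((orb3 σ.onPoints Q).filter fun q' => q' ∈ b).card
      + (univ.filter fun q : P => q ∈ a ∧ q ∉ orb3 σ.onPoints Q ∧ ∃ q' ∈ orb3 σ.onPoints q, q' ∈ b).card = 3 := by
  -- a is not in the orbit of b: every line of that orbit passes through the fixed point y
  have hyσ : ∀ m : L, y ∈ m → y ∈ σ.onLines m := fun m hm => by have := σ.mem_map hm; rwa [hy] at this
  have hab : a ∉ orb3 σ.onLines b := by
    intro h; rw [mem_orb3] at h
    have hya : y ∈ a := by
      rcases h with rfl | rfl | rfl
      · exact hyb
      · exact hyσ _ hyb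
      · exact hyσ _ (hyσ _ hyb)
    exact ha0 y hya hy
  have h := σ.orbit_row_identity_noFixed hq hb ha0
  rw [if_neg hab, ← Finset.sum_filter_add_sum_filter_not (univ.filter fun q : P => q ∈ a)
    (fun q => q ∈ orb3 σ.onPoints Q)] at h
  -- the own-orbit part: q ∈ {Q, σQ}, each contributing |orb3 Q ∩ b|
  have hown : ((univ.filter fun q : P => q ∈ a).filter fun q => q ∈ orb3 σ.onPoints Q) = {Q, σ.onPoints Q} := by
    rw [← σ.filter_orb3_eq_pair_of_side hQ ha hQa hσQa]
    ext q; simp only [mem_filter, mem_univ, true_and]; tauto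
  have hQσQ : Q ≠ σ.onPoints Q := fun e => hQ e.symm
  rw [hown, sum_pair hQσQ, orb3_eq_of_mem σ.onPoints hq ((mem_orb3 _ _ _).2 (Or.inr (Or.inl rfl))), ← two_mul] at h
  -- the other part: 0/1 terms
  have hb1 := σ.card_orb3_inter_le_one_of_fixed_mem hq hb hy hyb
  have h01 : ∀ q : P, ((orb3 σ.onPoints q).filter fun q' => q' ∈ b).card
      = if ∃ q' ∈ orb3 σ.onPoints q, q' ∈ b then 1 else 0 := by
    intro q
    split_ifs with hex
    · obtain ⟨q', hq', hq'b⟩ := hex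
      have hpos : 0 < ((orb3 σ.onPoints q).filter fun q' => q' ∈ b).card := card_pos.2 ⟨q', mem_filter.2 ⟨hq', hq'b⟩⟩
      have := hb1 q; omega
    · rw [card_eq_zero, filter_eq_empty_iff]; exact fun q' hq' hq'b => hex ⟨q', hq', hq'b⟩
  have hrest : ∑ q ∈ (univ.filter fun q : P => q ∈ a).filter (fun q => q ∉ orb3 σ.onPoints Q),
      ((orb3 σ.onPoints q).filter fun q' => q' ∈ b).card
      = (univ.filter fun q : P => q ∈ a ∧ q ∉ orb3 σ.onPoints Q ∧ ∃ q' ∈ orb3 σ.onPoints q, q' ∈ b).card := by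
    rw [Finset.sum_congr rfl (fun q _ => h01 q), Finset.sum_boole, Nat.cast_id]
    congr 1; ext q; simp only [mem_filter, mem_univ, true_and, and_assoc]
  rw [hrest] at h
  exact h

/-- **(R1) at plane level.** `σ³ = 1`; `a` a side of the orbit of `Q` (non-fixed line through `Q, σQ`, no fixed point), `b` a side
of the orbit of `Q'`, the two orbits different. Then
`2 · |orb3 Q ∩ b| + 2 · |orb3 Q' ∩ a| + #{q ∈ a, q ∉ orb3 Q ∪ orb3 Q' : orb3 q meets b} = 3`
(orbit matrix: `2[ψ i' = i] + 2[ψ i = i'] + [κ = κ'] + |R ∩ R'| + … + #{j : γ_j(i) = γ_j(i')} = 3`). -/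
theorem side_side_identity (hq : σ.onPoints ^ 3 = 1) {Q Q' : P} (hQ : σ.onPoints Q ≠ Q) (hQ' : σ.onPoints Q' ≠ Q')
    (hQQ' : orb3 σ.onPoints Q ≠ orb3 σ.onPoints Q')
    {a : L} (ha : σ.onLines a ≠ a) (hQa : Q ∈ a) (hσQa : σ.onPoints Q ∈ a) (ha0 : ∀ q : P, q ∈ a → σ.onPoints q ≠ q)
    {b : L} (hb : σ.onLines b ≠ b) (hQ'b : Q' ∈ b) (hσQ'b : σ.onPoints Q' ∈ b) :
    2 * ((orb3 σ.onPoints Q).filter fun q' => q' ∈ b).card + 2 * ((orb3 σ.onPoints Q').filter fun q' => q' ∈ a).card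
      + (univ.filter fun q : P => q ∈ a ∧ q ∉ orb3 σ.onPoints Q ∧ q ∉ orb3 σ.onPoints Q' ∧
          ∃ q' ∈ orb3 σ.onPoints q, q' ∈ b).card = 3 := by
  have h3Q' := apply_three σ.onPoints hq Q'
  -- a is not in the orbit of b (the lines of that orbit are sides of the orbit of Q', which a meets at most once)
  have hbown : ((orb3 σ.onPoints Q').filter fun q => q ∈ b) = {Q', σ.onPoints Q'} :=
    σ.filter_orb3_eq_pair_of_side hQ' hb hQ'b hσQ'b
  have hab : a ∉ orb3 σ.onLines b := by
    intro h
    -- every line of orb3 b contains two points of orb3 Q'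
    have two : 2 ≤ ((orb3 σ.onPoints Q').filter fun q => q ∈ a).card := by
      rw [mem_orb3] at h
      have pair : ∀ x : P, x ∈ orb3 σ.onPoints Q' → σ.onPoints x ∈ orb3 σ.onPoints Q' → x ≠ σ.onPoints x →
          x ∈ a → σ.onPoints x ∈ a → 2 ≤ ((orb3 σ.onPoints Q').filter fun q => q ∈ a).card := by
        intro x hx hσx hne hxa hσxa
        have hsub : ({x, σ.onPoints x} : Finset P) ⊆ (orb3 σ.onPoints Q').filter fun q => q ∈ a := by
          intro z hz; rw [mem_insert, mem_singleton] at hz; rw [mem_filter]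
          rcases hz with rfl | rfl
          · exact ⟨hx, hxa⟩
          · exact ⟨hσx, hσxa⟩
        have := card_le_card hsub; rwa [card_pair hne] at this
      have m0 : Q' ∈ orb3 σ.onPoints Q' := self_mem_orb3 _ _
      have m1 : σ.onPoints Q' ∈ orb3 σ.onPoints Q' := (mem_orb3 _ _ _).2 (Or.inr (Or.inl rfl))
      have m2 : σ.onPoints (σ.onPoints Q') ∈ orb3 σ.onPoints Q' := (mem_orb3 _ _ _).2 (Or.inr (Or.inr rfl))
      have n1 : σ.onPoints Q' ≠ σ.onPoints (σ.onPoints Q') := fun e => hQ' (σ.onPoints.injective e).symm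
      have n2 : σ.onPoints (σ.onPoints Q') ≠ σ.onPoints (σ.onPoints (σ.onPoints Q')) := by
        rw [h3Q']; intro e; apply hQ'; have := congrArg σ.onPoints e; rw [h3Q'] at this; exact this.symm
      rcases h with rfl | rfl | rfl
      · exact pair Q' m0 m1 (fun e => hQ' e.symm) hQ'b hσQ'b
      · exact pair (σ.onPoints Q') m1 m2 n1 (σ.mem_map hQ'b) (σ.mem_map hσQ'b)
      · refine pair (σ.onPoints (σ.onPoints Q')) m2 (by rw [h3Q']; exact m0) n2 (σ.mem_map (σ.mem_map hQ'b)) ?_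
        exact σ.mem_map (σ.mem_map hσQ'b)
    have twoQ : 2 ≤ ((orb3 σ.onPoints Q).filter fun q => q ∈ a).card := by
      rw [σ.filter_orb3_eq_pair_of_side hQ ha hQa hσQa, card_pair (fun e => hQ e.symm)]
    exact hQQ' (σ.orb3_eq_of_two_le hq ha twoQ two)
  have h := σ.orbit_row_identity_noFixed hq hb ha0
  rw [if_neg hab] at h
  -- split the points of a into: orbit of Q | orbit of Q' | the rest
  rw [← Finset.sum_filter_add_sum_filter_not (univ.filter fun q : P => q ∈ a) (fun q => q ∈ orb3 σ.onPoints Q)] at h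
  have hown : ((univ.filter fun q : P => q ∈ a).filter fun q => q ∈ orb3 σ.onPoints Q) = {Q, σ.onPoints Q} := by
    rw [← σ.filter_orb3_eq_pair_of_side hQ ha hQa hσQa]
    ext q; simp only [mem_filter, mem_univ, true_and]; tauto
  rw [hown, sum_pair (fun e => hQ e.symm), orb3_eq_of_mem σ.onPoints hq ((mem_orb3 _ _ _).2 (Or.inr (Or.inl rfl))),
    ← two_mul] at h
  rw [← Finset.sum_filter_add_sum_filter_not (((univ.filter fun q : P => q ∈ a).filter
    fun q => q ∉ orb3 σ.onPoints Q)) (fun q => q ∈ orb3 σ.onPoints Q')] at h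
  -- the orbit-of-Q' part: Σ over (orb3 Q' ∩ a) of |orb3 Q' ∩ b| = |orb3 Q' ∩ a| · 2
  have hmid : ∑ q ∈ (((univ.filter fun q : P => q ∈ a).filter fun q => q ∉ orb3 σ.onPoints Q).filter
      fun q => q ∈ orb3 σ.onPoints Q'), ((orb3 σ.onPoints q).filter fun q' => q' ∈ b).card
      = 2 * ((orb3 σ.onPoints Q').filter fun q' => q' ∈ a).card := by
    have hset : (((univ.filter fun q : P => q ∈ a).filter fun q => q ∉ orb3 σ.onPoints Q).filter
        fun q => q ∈ orb3 σ.onPoints Q') = (orb3 σ.onPoints Q').filter fun q' => q' ∈ a := by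
      ext q; simp only [mem_filter, mem_univ, true_and]
      constructor
      · rintro ⟨⟨hqa, -⟩, hqQ'⟩; exact ⟨hqQ', hqa⟩
      · rintro ⟨hqQ', hqa⟩
        refine ⟨⟨hqa, fun hqQ => hQQ' ?_⟩, hqQ'⟩
        rw [← orb3_eq_of_mem σ.onPoints hq hqQ, ← orb3_eq_of_mem σ.onPoints hq hqQ']
    rw [hset]
    rw [Finset.sum_congr rfl (fun q hq' => by
      rw [orb3_eq_of_mem σ.onPoints hq (mem_filter.1 hq').1, hbown, card_pair (fun e => hQ' e.symm)]),
      Finset.sum_const, smul_eq_mul, mul_comm]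
  rw [hmid] at h
  -- the rest: 0/1 terms (b meets only the orbit of Q' twice)
  have hb1 : ∀ q : P, q ∉ orb3 σ.onPoints Q' → ((orb3 σ.onPoints q).filter fun q' => q' ∈ b).card ≤ 1 := by
    intro q hq'
    by_contra hlt
    have two : 2 ≤ ((orb3 σ.onPoints q).filter fun q' => q' ∈ b).card := by omega
    have twoQ' : 2 ≤ ((orb3 σ.onPoints Q').filter fun q' => q' ∈ b).card := by
      rw [hbown, card_pair (fun e => hQ' e.symm)]
    have e := σ.orb3_eq_of_two_le hq hb two twoQ'
    exact hq' (by rw [← e]; exact self_mem_orb3 _ _)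
  have h01 : ∀ q : P, q ∉ orb3 σ.onPoints Q' → ((orb3 σ.onPoints q).filter fun q' => q' ∈ b).card
      = if ∃ q' ∈ orb3 σ.onPoints q, q' ∈ b then 1 else 0 := by
    intro q hqn
    split_ifs with hex
    · obtain ⟨q', hq', hq'b⟩ := hex
      have hpos : 0 < ((orb3 σ.onPoints q).filter fun q' => q' ∈ b).card := card_pos.2 ⟨q', mem_filter.2 ⟨hq', hq'b⟩⟩
      have := hb1 q hqn; omega
    · rw [card_eq_zero, filter_eq_empty_iff]; exact fun q' hq' hq'b => hex ⟨q', hq', hq'b⟩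
  have hrest : ∑ q ∈ (((univ.filter fun q : P => q ∈ a).filter fun q => q ∉ orb3 σ.onPoints Q).filter
      fun q => q ∉ orb3 σ.onPoints Q'), ((orb3 σ.onPoints q).filter fun q' => q' ∈ b).card
      = (univ.filter fun q : P => q ∈ a ∧ q ∉ orb3 σ.onPoints Q ∧ q ∉ orb3 σ.onPoints Q' ∧
          ∃ q' ∈ orb3 σ.onPoints q, q' ∈ b).card := by
    rw [Finset.sum_congr rfl (fun q hq' => h01 q (mem_filter.1 hq').2), Finset.sum_boole, Nat.cast_id]
    congr 1; ext q; simp only [mem_filter, mem_univ, true_and, and_assoc]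
  rw [hrest] at h
  omega

/-! ### The column equations by duality: (C4), (C3), (C1)/(C2) of FAMILY-FLAG7 §1 at plane level -/

/-- **(C4) at plane level** (dual of `flag_tlines_common_orbits`): two points `x ≠ c`, `x' ≠ c` on different fixed lines
`m ≠ m'` (both `≠ l`) of a flag-type collineation lie on exactly three common non-trivial LINE orbits:
`#{e ∋ x : σe ≠ e, some line of orb3 e passes through x'} = 3`
(orbit matrix: `#{i : γ_j(i) = t, γ_j'(i) = t'} + #{(k,C) : β_kj(C) = t, β_kj'(C) = t'} = 3`). -/
theorem flag_tpoints_common_orbits (hq : σ.onPoints ^ 3 = 1) {l : L} {c : P} (hcl : c ∈ l)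
    (hP : ∀ x : P, σ.onPoints x = x → x ∈ l) (hL : ∀ m : L, σ.onLines m = m → c ∈ m)
    {m m' : L} (hm : σ.onLines m = m) (hm' : σ.onLines m' = m') (hmm' : m ≠ m') (hml : m ≠ l) (hm'l : m' ≠ l)
    {x x' : P} (hxm : x ∈ m) (hxc : x ≠ c) (hx'm' : x' ∈ m') (hx'c : x' ≠ c) :
    (univ.filter fun e : L => x ∈ e ∧ σ.onLines e ≠ e ∧ ∃ e' ∈ orb3 σ.onLines e, x' ∈ e').card = 3 := by
  have hqL : σ.onLines ^ 3 = 1 := σ.onLines_pow_eq_one hq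
  exact σ.dual.flag_tlines_common_orbits (l := (c : Dual P)) (c := (l : Dual L)) hqL hcl hL hP hm hm' hmm' hml hm'l
    hxm hxc hx'm' hx'c

/-- **(C3) at plane level** (dual of `side_tline_identity`): `x` a non-fixed point on no fixed line lying on the non-fixed line `e`
and on `σe` (a vertex of an exterior orbit-triangle and one of its side orbits), `z` a non-fixed point on a fixed line `m`
(a 'T-point'). Then `2 · #{e' ∈ orb3 e : z ∈ e'} + #{g ∋ x, g ∉ orb3 e : some line of orb3 g passes through z} = 3`. -/
theorem vertex_tpoint_identity (hq : σ.onPoints ^ 3 = 1) {e : L} (he : σ.onLines e ≠ e) {x : P} (hx : σ.onPoints x ≠ x)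
    (hxe : x ∈ e) (hxσe : x ∈ σ.onLines e) (hx0 : ∀ g : L, x ∈ g → σ.onLines g ≠ g)
    {z : P} (hz : σ.onPoints z ≠ z) {m : L} (hm : σ.onLines m = m) (hzm : z ∈ m) :
    2 * ((orb3 σ.onLines e).filter fun e' => z ∈ e').card
      + (univ.filter fun g : L => x ∈ g ∧ g ∉ orb3 σ.onLines e ∧ ∃ g' ∈ orb3 σ.onLines g, z ∈ g').card = 3 := by
  have hqL : σ.onLines ^ 3 = 1 := σ.onLines_pow_eq_one hq
  exact σ.dual.side_tline_identity (Q := (e : Dual L)) (a := (x : Dual P)) (b := (z : Dual P)) (y := (m : Dual L))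
    hqL he hx hxe hxσe hx0 hz hm hzm

/-- **(C1)/(C2) at plane level** (dual of `side_side_identity`): `x` on `e, σe` and `x'` on `e', σe'` two such vertices with
different side orbits `orb3 e ≠ orb3 e'`, both on no fixed line. Then
`2 · #{g ∈ orb3 e : x' ∈ g} + 2 · #{g ∈ orb3 e' : x ∈ g} + #{g ∋ x, g ∉ orb3 e ∪ orb3 e' : some line of orb3 g passes through x'} = 3`. -/
theorem vertex_vertex_identity (hq : σ.onPoints ^ 3 = 1) {e e' : L} (he : σ.onLines e ≠ e) (he' : σ.onLines e' ≠ e')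
    (hee' : orb3 σ.onLines e ≠ orb3 σ.onLines e')
    {x : P} (hx : σ.onPoints x ≠ x) (hxe : x ∈ e) (hxσe : x ∈ σ.onLines e) (hx0 : ∀ g : L, x ∈ g → σ.onLines g ≠ g)
    {x' : P} (hx' : σ.onPoints x' ≠ x') (hx'e' : x' ∈ e') (hx'σe' : x' ∈ σ.onLines e') :
    2 * ((orb3 σ.onLines e).filter fun g => x' ∈ g).card + 2 * ((orb3 σ.onLines e').filter fun g => x ∈ g).card
      + (univ.filter fun g : L => x ∈ g ∧ g ∉ orb3 σ.onLines e ∧ g ∉ orb3 σ.onLines e' ∧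
          ∃ g' ∈ orb3 σ.onLines g, x' ∈ g').card = 3 := by
  have hqL : σ.onLines ^ 3 = 1 := σ.onLines_pow_eq_one hq
  exact σ.dual.side_side_identity (Q := (e : Dual L)) (Q' := (e' : Dual L)) (a := (x : Dual P)) (b := (x' : Dual P))
    hqL he he' hee' hx hxe hxσe hx0 hx' hx'e' hx'σe'

/-- **(C5)/(C6) at plane level** (dual of `card_common_orbits_eq_three`): `z` a non-fixed point on a fixed line `m` (so every line
orbit has at most one line through `z`), `x` a point all of whose fixed lines equal a given line `m₀` not through `z` (e.g. `x` on no
fixed line at all, or `x ≠ c` on the fixed line `m₀`), `x ∉ orb3 z`. Then exactly three of the lines through `x` are non-fixed with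
orbit reaching `z`: `#{g ∋ x : σg ≠ g, some line of orb3 g passes through z} = 3`
(orbit matrix, flag cells: `2[κ(i) = t] + #{i'' : ψ(i'') = i or i ∈ R(i''), κ(i'') = t} = 3` and `#{i : κ(i) = t, γ_j(i) = t'} = 3`). -/
theorem point_common_lineOrbits_eq_three (hq : σ.onPoints ^ 3 = 1) {z : P} (hz : σ.onPoints z ≠ z) {m : L}
    (hm : σ.onLines m = m) (hzm : z ∈ m) {x : P} {m₀ : L} (hx : ∀ g : L, x ∈ g → σ.onLines g = g → g = m₀)
    (hzm₀ : z ∉ m₀) (hxz : x ∉ orb3 σ.onPoints z) :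
    (univ.filter fun g : L => x ∈ g ∧ σ.onLines g ≠ g ∧ ∃ g' ∈ orb3 σ.onLines g, z ∈ g').card = 3 := by
  have hqL : σ.onLines ^ 3 = 1 := σ.onLines_pow_eq_one hq
  exact σ.dual.card_common_orbits_eq_three (b := (z : Dual P)) (a := (x : Dual P)) (y := (m₀ : Dual L)) hqL hz hx hzm₀ hxz
    (σ.dual.card_orb3_inter_le_one_of_fixed_mem hqL hz hm hzm)

/-! ### The orbit matrix indexed by the orbits themselves -/

/-- The set of non-trivial point orbits of `σ` (`σ³ = 1`), as a finset of finsets. -/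
noncomputable def orbits3 : Finset (Finset P) := (univ.filter fun p : P => σ.onPoints p ≠ p).image (orb3 σ.onPoints)

/-- **Orbit-matrix row identity, indexed by the orbits.** For `σ³ = 1`, a non-fixed line `b` and any line `a`:
`3 · #{q ∈ a ∩ b : σq = q} + Σ_{S ∈ orbits3 σ} |S ∩ a| · |S ∩ b| = 3 + n · [a ∈ orb3 b]`.
Here `|S ∩ a|` is the orbit-matrix entry `M_{A,S}` (the same for every line of the orbit `A` of `a`, `card_filter_mem_mapLine`), so this is
literally the `λ = 1` equation `Σ_S M_{A,S} M_{B,S} + 3·(common fixed points) = 3 + n·[A = B]` of the tactical decomposition of `⟨σ⟩`,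
with no choice of representatives. -/
theorem orbit_row_identity_orbits (hq : σ.onPoints ^ 3 = 1) {b : L} (hb : σ.onLines b ≠ b) (a : L) :
    3 * (univ.filter fun q : P => q ∈ a ∧ q ∈ b ∧ σ.onPoints q = q).card
      + ∑ S ∈ σ.orbits3, (S.filter fun q => q ∈ a).card * (S.filter fun q => q ∈ b).card
      = if a ∈ orb3 σ.onLines b then ProjectivePlane.order P L + 3 else 3 := by
  rw [← σ.orbit_row_identity hq hb a,
    ← Finset.sum_filter_add_sum_filter_not (univ.filter fun q : P => q ∈ a) (fun q => σ.onPoints q = q)]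
  congr 1
  · rw [Finset.filter_filter, Finset.card_eq_sum_ones, Finset.mul_sum]
    rw [show (univ.filter fun q : P => q ∈ a ∧ q ∈ b ∧ σ.onPoints q = q)
        = (univ.filter fun q : P => q ∈ a ∧ σ.onPoints q = q).filter (fun q => q ∈ b) by
          ext q; simp only [mem_filter, mem_univ, true_and]; tauto]
    rw [Finset.sum_filter]
    refine Finset.sum_congr rfl fun q hq' => ?_
    rw [mem_filter] at hq'
    unfold orbWeight; rw [if_pos hq'.2.2]; split_ifs <;> simp
  · -- regroup the non-fixed points of a by their orbit
    set A := (univ.filter fun q : P => q ∈ a).filter (fun q => ¬ σ.onPoints q = q) with hA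
    have hw : ∀ q ∈ A, σ.orbWeight b q = ((orb3 σ.onPoints q).filter fun q' => q' ∈ b).card := by
      intro q hq'; rw [hA, mem_filter] at hq'; unfold orbWeight; rw [if_neg hq'.2]
    rw [Finset.sum_congr rfl hw]
    have himg : ∀ q ∈ A, orb3 σ.onPoints q ∈ σ.orbits3 := by
      intro q hq'; rw [hA, mem_filter, mem_filter] at hq'
      exact mem_image.2 ⟨q, mem_filter.2 ⟨mem_univ _, hq'.2⟩, rfl⟩
    rw [← Finset.sum_fiberwise_of_maps_to himg]
    refine Finset.sum_congr rfl fun S hS => ?_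
    -- the fibre over S: the points q of A with orb3 q = S are exactly the points of S on a
    obtain ⟨p, hp, rfl⟩ := mem_image.1 hS
    rw [mem_filter] at hp
    have hfib : A.filter (fun q => orb3 σ.onPoints q = orb3 σ.onPoints p) = (orb3 σ.onPoints p).filter fun q => q ∈ a := by
      ext q
      simp only [hA, mem_filter, mem_univ, true_and]
      constructor
      · rintro ⟨⟨hqa, -⟩, he⟩
        exact ⟨by rw [← he]; exact self_mem_orb3 _ _, hqa⟩
      · rintro ⟨hqp, hqa⟩
        refine ⟨⟨hqa, fun hqf => hp.2 ?_⟩, orb3_eq_of_mem _ hq hqp⟩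
        have e := orb3_eq_of_mem σ.onPoints hq hqp
        rw [orb3_of_fixed _ hqf] at e
        have : p ∈ ({q} : Finset P) := by rw [e]; exact self_mem_orb3 _ _
        rw [mem_singleton] at this; rw [this]; exact hqf
    rw [hfib, Finset.card_eq_sum_ones ((orb3 σ.onPoints p).filter fun q => q ∈ a), Finset.sum_mul]
    refine Finset.sum_congr rfl fun q hq' => ?_
    rw [one_mul, orb3_eq_of_mem σ.onPoints hq (mem_filter.1 hq').1]

/-- The set of non-trivial line orbits. -/
noncomputable def lineOrbits3 : Finset (Finset L) := (univ.filter fun m : L => σ.onLines m ≠ m).image (orb3 σ.onLines)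

/-- **Orbit-matrix column identity, indexed by the orbits** (dual): for a non-fixed point `p` and any point `q`:
`3 · #{m ∋ p, q : σm = m} + Σ_{B ∈ lineOrbits3 σ} #{m ∈ B : q ∈ m} · #{m ∈ B : p ∈ m} = 3 + n · [q ∈ orb3 p]`. -/
theorem orbit_column_identity_orbits (hq : σ.onPoints ^ 3 = 1) {p : P} (hp : σ.onPoints p ≠ p) (q : P) :
    3 * (univ.filter fun m : L => q ∈ m ∧ p ∈ m ∧ σ.onLines m = m).card
      + ∑ B ∈ σ.lineOrbits3, (B.filter fun m => q ∈ m).card * (B.filter fun m => p ∈ m).card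
      = if q ∈ orb3 σ.onPoints p then ProjectivePlane.order P L + 3 else 3 := by
  have hqL : σ.onLines ^ 3 = 1 := σ.onLines_pow_eq_one hq
  have h := σ.dual.orbit_row_identity_orbits (a := (q : Dual P)) (b := (p : Dual P)) hqL hp
  rw [ProjectivePlane.Dual.order] at h
  exact h

end Collineation

end Summit.Ventures.DiscreteObjects.PP12
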